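/-
Copyright: the b2b-balaban T⁴-continuum CRUX team, row NE7b leaf lineage `t4-ne7b-formalise-leaf-01` (gen 86). Project licence.
-/
import Summits.QuantumFields.BalabanUV.T4Continuum.Spine.NE7b.BlockSectionAgmonEngine

/-!
# THE A-POSTERIORI AGMON LETTER FOR THE ONE-SHOT BLOCK-MEAN SECTION ON `ℤ^d` AND ITS ROW-SUM SOCKET, BY VALUE:
# for EVERY finitely supported competitor `φ` with the section's block sums, `(gap − d·η)·‖w∘blk·(H(·,0) − φ)‖_{ℓ²} ≤ ‖w∘blk·P(−Δ)φ‖_{ℓ²}`, hence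
# `Σ_{y∈Y}|H(p,y)| ≤ Σ_{y∈Y}|φ(p − (n+1)y)| + (Σ_{y∈Y} w(blk p − y)⁻²)^{1∕2}·‖w∘blk·P(−Δ)φ‖_{ℓ²}∕(gap − d·η)` — T-111's road (A) with a FINITE right side
# (row NE7b, node U5c; PRICING-NE7b v124 §3 NL-NE7b-1′ limb 1b (e1)–(e3); [folklore] over `BlockSectionAgmonEngine` + `B5Hk103Unique`∕`B5Hk165TranslZd` BY NAME)

Cell `pub-balaban`, sub-cell `t4`, spine estimate NE7b (`T4WeightBudget.RelWeightBound`; the cell's OWN estimate — NOT PRINTED in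
[Bałaban 1983–89], NOT PROVED).  Crux-route work under `Spine/NE7b/` by a row leaf (`t4-ne7b-formalise-leaf-01` gen 86) under FREEZE (0)'s
crux-prover clause; NOTHING of Bałaban's is named as a Lean object, valued or asserted; no `T4Continuum/Support` leaf typed; no `def` (the competitor
`φ`, its support `S`, the residual window `T`, the block weight `w` and the constants are CARRIED BY HYPOTHESES; the residual `P(−Δ)φ` is DISPLAYED as
`lapRow φ q − ((n+1)^d)⁻¹·Σ_{r∈B(blk q)} lapRow φ r`); zero `sorry`.  Imports: this lineage's `BlockSectionAgmonEngine` (the abstract bound, §2 there) and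
through it `B5Hk165TranslZd` ∕ `B5Hk103Unique` ∕ `B5Hk103ScalarZd` (the section `kerH`, `Q′H = 1` as `sum_B_kerH`, the weak Euler–Lagrange equation
`weakEL_kerH_col` ∕ `lapRow_eq_of_blk_eq`, `summable_kerH_sq`, translation covariance `kerH_eq_col_zero`).

WHY.  PRICING-NE7b v124 §3: NL-NE7b-1′ limb 1b (the chart letter BY VALUE at a small fixed side, MIXED currency of record, W-ne7bp1-g113-3) is OPEN AT
KERNEL WEIGHT — F733 (e): (e1) explicit decay letter for `kerH`, (e2) near-field values, (e3) images ∕ truncation identity, «none typed or claimed»;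
T-111 ∕ F745: at `M = 2`, `d = 4` the cheapest certificate is ONE number `ρ_∞ = Σ_{y∈ℤ⁴}|H(p,y)| ≤ 2.70` (`< 1 + √3`).  THIS FILE reads the engine on
`D = H(·,0) − φ`: for ANY finitely supported `φ` whose block sums are the section's (`(n+1)^d·δ_{y0}`), `D ∈ ℓ²` has zero block sums and
`(−Δ)D = (c − m_φ)∘blk − P(−Δ)φ` with `c∘blk = (−Δ)H(·,0)` block-constant (weak Euler–Lagrange) and `m_φ` the block means of `(−Δ)φ`; so (§1)
`(gap − dη)·‖w∘blk·D‖ ≤ ‖w∘blk·P(−Δ)φ‖` and POINTWISE `|H(q,0) − φ q| ≤ w(blk q)⁻¹·‖w∘blk·P(−Δ)φ‖∕(gap − dη)` — an explicit `(q, W)`-type decay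
letter for every admissible `φ` (a-priori with `φ := 𝟙_{B(0)}`); and (§2) by translation covariance and Cauchy–Schwarz against the weight, the ROW SUMS
`Σ_{y∈Y}|H(p,y)|` over any finite coarse window are bounded by `φ`'s own row sum plus `(Σ_Y w(blk p − y)⁻²)^{1∕2}` times that norm: (e2)+(e3) have become
the CHOICE OF `φ` — no transcendental kernel value, no torus section object, no periodisation identity; the right side is a finite rational expression
once `φ`, `w` are rational (`w = (3∕2)^{min(|·|₁,T)}`: sibling `BlockSectionRowSumCertificate`).

WHAT IS PROVED (every `d`, every block side `n + 1 ≥ 2`, every `a > 0`; all [folklore]):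
* §1 **`agmon_kerH`** (`(gap − d·η)·√(Σ'_q (w(blk q)·(H(q,0) − φ q))²) ≤ √(Σ_{q∈T}(w(blk q)·P(−Δ)φ q)²)`), **`abs_kerH_sub_le`** (pointwise, `gap − dη > 0`).
* §2 **`rowSum_kerH_sub_competitor_le`** (`Σ_{y∈Y}|kerH n a p y − φ(p − bshift n y)| ≤ √(Σ_{y∈Y}(w(blk p − y))⁻²)·√(Σ'_q(w(blk q)·(H(q,0) − φ q))²)`),
  **`rowSum_kerH_sub_le`** (against any coarse reference `g`: `Σ_Y|H(p,y) − g y| ≤ Σ_Y|φ(p − bshift n y) − g y| + …` — T-111's `Ct(x)` shape, `g = δ₀`),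
  **`rowSum_kerH_le`** (`g = 0`),
  **`rowSum_kerH_le_of_residual`** (the two combined), **`tsum_abs_kerH_le_of_family`** (a weight FAMILY, one admissible weight per window with
  `Σ_Y w(blk p − y)⁻² ≤ Cw` and `Σ_T(w∘blk·P(−Δ)φ)² ≤ Rb²` — a single bounded weight cannot do both on `ℤ^d`, refuter g104 F753 (b) — and `φ`'s row sums `≤ A`
  ⟹ summable and `Σ'_y |kerH n a p y| ≤ A + √Cw·Rb∕(gap − dη)` — the (A-cert) shape; `BlockSectionRowSumCertificate` supplies the family `t^{min(|·|₁, T(Y))}`).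

HONEST: [folklore]; no number certified here; the side-2 gap and the weight family are the sibling files'; `ℤ^d` object; scalar `U = 1` skeleton —
nothing of (A3) ∕ NC-NE7b-α; BY-NAME EFFECT ON THE WALL: NONE.  NE7b NOT PRINTED ∕ NOT PROVED; spine PROVED 0∕9; rung (B)+1 on a FINITE torus — NOT
infinite volume, NOT the mass gap, NOT Clay.  HONEST DEPENDENCY: continuum YM on T⁴ ⇐ BetaPertH ∧ nine spine estimates (0∕9 proved); BetaPertH ⇐ (D1) ∧
(D4) ∧ CAP+tail; G-an2-4 gates asym, D1 and NE2∕3∕4.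
-/

set_option autoImplicit false

namespace Summit.QuantumFields.BalabanUV.T4Continuum.NE7b.BlockSectionAgmonLetter

open Finset
open Literature.MathematicalPhysics.QuantumFieldTheory.Balaban1983to89
open B6QGQLower276 (X B e blk loc mem_B chart blk_chart locFin)
open B5Hk103ScalarZd (kerH)
open B5Hk103Unique (lapRow lapRow_eq_of_blk_eq summable_kerH_sq sum_B_kerH weakEL_kerH_col)
open B5Hk165TranslZd (bshift kerH_eq_col_zero)
open B5Ineq167UpperZd (summable_sq_of_support)
open Summit.QuantumFields.BalabanUV.T4Continuum.NE7b.BlockSectionAgmonEngine (engine lapRow_sub' blk_sub_bshift sub_bshift_injective)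

noncomputable section

variable {d : ℕ}

/-! ## §1  The letter for the section `H(·, 0) = kerH n a · 0` against a finitely supported competitor `φ` [folklore] -/

/-- **THE A-POSTERIORI AGMON LETTER FOR THE ONE-SHOT SECTION.**  For every finitely supported `φ` with the section's block sums
(`Σ_{q∈B(y)} φ q = (n+1)^d·δ_{y0}`), every residual window `T` (outside which
`P(−Δ)φ := lapRow φ q − ((n+1)^d)⁻¹Σ_{r∈B(blk q)} lapRow φ r` vanishes), every block weight as in the engine and every intra-block gap `gap`:
`(gap − d·η)·√(Σ'_q (w(blk q)·(H(q,0) − φ q))²) ≤ √(Σ_{q∈T} (w(blk q)·P(−Δ)φ(q))²)`. [folklore] -/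
theorem agmon_kerH (n : ℕ) (hn : 1 ≤ n) {a : ℝ} (ha : 0 < a) (φ : X d → ℝ) (S : Finset (X d)) (hS : ∀ q ∉ S, φ q = 0)
    (hφ : ∀ y : X d, ∑ q ∈ B n y, φ q = ((n : ℝ) + 1) ^ d * (if y = 0 then 1 else 0))
    (T : Finset (X d))
    (hT : ∀ q ∉ T, lapRow φ q - (((n : ℝ) + 1) ^ d)⁻¹ * ∑ r ∈ B n (blk n q), lapRow φ r = 0)
    (w : X d → ℝ) (η W : ℝ) (hw0 : ∀ y, 0 < w y) (hwW : ∀ y, w y ≤ W) (hη : 0 ≤ η)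
    (hwρ : ∀ (y : X d) (μ : Fin d), w y / w (y + e μ) + w (y + e μ) / w y ≤ 2 + 2 * η)
    (gap : ℝ)
    (hgap : ∀ (y : X d) (u : X d → ℝ), ∑ q ∈ B n y, u q = 0 →
      gap * ∑ q ∈ B n y, u q ^ 2 ≤ ∑ q ∈ B n y, ∑ μ : Fin d, (if loc n q μ < n then (u q - u (q + e μ)) ^ 2 else 0)) :
    (gap - d * η) * Real.sqrt (∑' q, (w (blk n q) * (kerH n a q 0 - φ q)) ^ 2) ≤
      Real.sqrt (∑ q ∈ T, (w (blk n q) * (lapRow φ q - (((n : ℝ) + 1) ^ d)⁻¹ * ∑ r ∈ B n (blk n q), lapRow φ r)) ^ 2) := by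
  classical
  -- `(−Δ)H(·,0)` is block-constant (weak Euler–Lagrange), `φ` is square-summable, `Q′(H − φ) = 0`
  set H0 : X d → ℝ := fun q => kerH n a q 0 with hH0
  set c : X d → ℝ := fun y => lapRow H0 (chart n y (locFin n 0)) with hc
  have hconst : ∀ q, lapRow H0 q = c (blk n q) := fun q =>
    lapRow_eq_of_blk_eq (weakEL_kerH_col n ha 0) (by rw [blk_chart])
  have hφ2 : Summable fun q => φ q ^ 2 := summable_sq_of_support hS
  have hD2 : Summable fun q => (H0 q - φ q) ^ 2 := by
    refine Summable.of_nonneg_of_le (fun q => sq_nonneg _) (fun q => ?_)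
      (((summable_kerH_sq n ha 0).mul_left 2).add (hφ2.mul_left 2))
    nlinarith [sq_nonneg (H0 q + φ q)]
  have hD0 : ∀ y : X d, ∑ q ∈ B n y, (H0 q - φ q) = 0 := by
    intro y
    rw [Finset.sum_sub_distrib, hφ y]
    simp only [hH0, sum_B_kerH n ha y 0, sub_self]
  refine engine n hn (fun q => H0 q - φ q)
    (fun y => c y - (((n : ℝ) + 1) ^ d)⁻¹ * ∑ r ∈ B n y, lapRow φ r)
    (fun q => lapRow φ q - (((n : ℝ) + 1) ^ d)⁻¹ * ∑ r ∈ B n (blk n q), lapRow φ r) T hD2 hD0 (fun q => ?_) hT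
    w η W hw0 hwW hη hwρ gap hgap
  rw [lapRow_sub', hconst q]
  ring

/-- **THE POINTWISE LETTER**: with `m := gap − d·η > 0`, for every site `q`,
`|H(q,0) − φ q| ≤ w(blk q)⁻¹·√(Σ_{T}(w∘blk·P(−Δ)φ)²)∕m` — an explicit `(q, W)`-type decay letter once `w` grows (e.g. `w = e^{κ min(|·|₁,T)}`),
a-priori with `φ := 𝟙_{B(0)}`. [folklore] -/
theorem abs_kerH_sub_le (n : ℕ) (hn : 1 ≤ n) {a : ℝ} (ha : 0 < a) (φ : X d → ℝ) (S : Finset (X d)) (hS : ∀ q ∉ S, φ q = 0)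
    (hφ : ∀ y : X d, ∑ q ∈ B n y, φ q = ((n : ℝ) + 1) ^ d * (if y = 0 then 1 else 0))
    (T : Finset (X d))
    (hT : ∀ q ∉ T, lapRow φ q - (((n : ℝ) + 1) ^ d)⁻¹ * ∑ r ∈ B n (blk n q), lapRow φ r = 0)
    (w : X d → ℝ) (η W : ℝ) (hw0 : ∀ y, 0 < w y) (hwW : ∀ y, w y ≤ W) (hη : 0 ≤ η)
    (hwρ : ∀ (y : X d) (μ : Fin d), w y / w (y + e μ) + w (y + e μ) / w y ≤ 2 + 2 * η)
    (gap : ℝ) (hm : 0 < gap - d * η)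
    (hgap : ∀ (y : X d) (u : X d → ℝ), ∑ q ∈ B n y, u q = 0 →
      gap * ∑ q ∈ B n y, u q ^ 2 ≤ ∑ q ∈ B n y, ∑ μ : Fin d, (if loc n q μ < n then (u q - u (q + e μ)) ^ 2 else 0))
    (q : X d) :
    |kerH n a q 0 - φ q| ≤ (w (blk n q))⁻¹ *
      (Real.sqrt (∑ r ∈ T, (w (blk n r) * (lapRow φ r - (((n : ℝ) + 1) ^ d)⁻¹ * ∑ s ∈ B n (blk n r), lapRow φ s)) ^ 2) /
        (gap - d * η)) := by
  have hmain := agmon_kerH n hn ha φ S hS hφ T hT w η W hw0 hwW hη hwρ gap hgap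
  have hW0 : 0 < W := lt_of_lt_of_le (hw0 0) (hwW 0)
  have hv2 : Summable fun r => (w (blk n r) * (kerH n a r 0 - φ r)) ^ 2 := by
    have hφ2 : Summable fun r => φ r ^ 2 := summable_sq_of_support hS
    have hD2 : Summable fun r => (kerH n a r 0 - φ r) ^ 2 := by
      refine Summable.of_nonneg_of_le (fun r => sq_nonneg _) (fun r => ?_)
        (((summable_kerH_sq n ha 0).mul_left 2).add (hφ2.mul_left 2))
      nlinarith [sq_nonneg (kerH n a r 0 + φ r)]
    refine Summable.of_nonneg_of_le (fun r => sq_nonneg _) (fun r => ?_) (hD2.mul_left (W ^ 2))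
    rw [mul_pow]
    exact mul_le_mul_of_nonneg_right (pow_le_pow_left₀ (hw0 _).le (hwW _) 2) (sq_nonneg _)
  -- one term of the `ℓ²` sum
  have hone : (w (blk n q) * (kerH n a q 0 - φ q)) ^ 2 ≤ ∑' r, (w (blk n r) * (kerH n a r 0 - φ r)) ^ 2 :=
    hv2.le_tsum q fun r _ => sq_nonneg _
  have hsq : w (blk n q) * |kerH n a q 0 - φ q| ≤ Real.sqrt (∑' r, (w (blk n r) * (kerH n a r 0 - φ r)) ^ 2) := by
    have h := Real.sqrt_le_sqrt hone
    rwa [Real.sqrt_sq_eq_abs, abs_mul, abs_of_pos (hw0 _)] at h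
  have hdiv : Real.sqrt (∑' r, (w (blk n r) * (kerH n a r 0 - φ r)) ^ 2) ≤
      Real.sqrt (∑ r ∈ T, (w (blk n r) * (lapRow φ r - (((n : ℝ) + 1) ^ d)⁻¹ * ∑ s ∈ B n (blk n r), lapRow φ s)) ^ 2) /
        (gap - d * η) := by
    rw [le_div_iff₀ hm, mul_comm]; exact hmain
  have hsq' : |kerH n a q 0 - φ q| ≤ (w (blk n q))⁻¹ * Real.sqrt (∑' r, (w (blk n r) * (kerH n a r 0 - φ r)) ^ 2) := by
    rw [← div_eq_inv_mul, le_div_iff₀ (hw0 _), mul_comm]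
    exact hsq
  exact hsq'.trans (mul_le_mul_of_nonneg_left hdiv (inv_nonneg.2 (hw0 _).le))


/-! ## §2  The row-sum socket: `Σ_{y∈Y}|H(p,y)|` against the competitor's data [folklore] -/

/-- **THE CORE ROW ESTIMATE**: for every fine site `p` and finite coarse window `Y`,
`Σ_{y∈Y}|H(p,y) − φ(p − (n+1)y)| ≤ √(Σ_{y∈Y} w(blk p − y)⁻²)·√(Σ'_q (w(blk q)·(H(q,0) − φ q))²)`
(translation covariance `H(p,y) = H(p − (n+1)y, 0)`, the sites `p − (n+1)y` are distinct, Cauchy–Schwarz against the weight). [folklore] -/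
theorem rowSum_kerH_sub_competitor_le (n : ℕ) {a : ℝ} (ha : 0 < a) (φ : X d → ℝ) (S : Finset (X d)) (hS : ∀ q ∉ S, φ q = 0)
    (w : X d → ℝ) (W : ℝ) (hw0 : ∀ y, 0 < w y) (hwW : ∀ y, w y ≤ W) (p : X d) (Y : Finset (X d)) :
    ∑ y ∈ Y, |kerH n a p y - φ (p - bshift n y)| ≤
      Real.sqrt (∑ y ∈ Y, ((w (blk n p - y))⁻¹) ^ 2) * Real.sqrt (∑' q, (w (blk n q) * (kerH n a q 0 - φ q)) ^ 2) := by
  classical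
  set v : X d → ℝ := fun q => w (blk n q) * (kerH n a q 0 - φ q) with hv
  have hv2 : Summable fun q => v q ^ 2 := by
    have hφ2 : Summable fun q => φ q ^ 2 := summable_sq_of_support hS
    have hD2 : Summable fun q => (kerH n a q 0 - φ q) ^ 2 := by
      refine Summable.of_nonneg_of_le (fun q => sq_nonneg _) (fun q => ?_)
        (((summable_kerH_sq n ha 0).mul_left 2).add (hφ2.mul_left 2))
      nlinarith [sq_nonneg (kerH n a q 0 + φ q)]
    refine Summable.of_nonneg_of_le (fun q => sq_nonneg _) (fun q => ?_) (hD2.mul_left (W ^ 2))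
    simp only [hv, mul_pow]
    exact mul_le_mul_of_nonneg_right (pow_le_pow_left₀ (hw0 _).le (hwW _) 2) (sq_nonneg _)
  -- termwise: `|H(p,y) − φ(p − (n+1)y)| = w(blk p − y)⁻¹·|v(p − (n+1)y)|`
  have hterm : ∀ y, |kerH n a p y - φ (p - bshift n y)| = (w (blk n p - y))⁻¹ * |v (p - bshift n y)| := by
    intro y
    rw [kerH_eq_col_zero n ha p y]
    have hw := hw0 (blk n p - y)
    simp only [hv, blk_sub_bshift, abs_mul, abs_of_pos hw]
    field_simp
  -- Cauchy–Schwarz on `Y`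
  have hCS : ∑ y ∈ Y, (w (blk n p - y))⁻¹ * |v (p - bshift n y)| ≤
      Real.sqrt (∑ y ∈ Y, ((w (blk n p - y))⁻¹) ^ 2) * Real.sqrt (∑ y ∈ Y, v (p - bshift n y) ^ 2) := by
    have h1 := Finset.sum_mul_sq_le_sq_mul_sq Y (fun y => (w (blk n p - y))⁻¹) (fun y => |v (p - bshift n y)|)
    have h2 : ∑ y ∈ Y, |v (p - bshift n y)| ^ 2 = ∑ y ∈ Y, v (p - bshift n y) ^ 2 :=
      Finset.sum_congr rfl fun y _ => sq_abs _
    rw [h2] at h1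
    have hnn : 0 ≤ ∑ y ∈ Y, (w (blk n p - y))⁻¹ * |v (p - bshift n y)| :=
      Finset.sum_nonneg fun y _ => mul_nonneg (inv_nonneg.2 (hw0 _).le) (abs_nonneg _)
    rw [← Real.sqrt_mul (Finset.sum_nonneg fun y _ => sq_nonneg _), ← Real.sqrt_sq hnn]
    exact Real.sqrt_le_sqrt h1
  have himg : ∑ y ∈ Y, v (p - bshift n y) ^ 2 ≤ ∑' q, v q ^ 2 := by
    rw [← Finset.sum_image (f := fun q => v q ^ 2) fun y₁ _ y₂ _ h => sub_bshift_injective n p h]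
    exact hv2.sum_le_tsum _ fun q _ => sq_nonneg _
  rw [Finset.sum_congr rfl fun y _ => hterm y]
  exact hCS.trans (mul_le_mul_of_nonneg_left (Real.sqrt_le_sqrt himg) (Real.sqrt_nonneg _))

/-- **ROW SUMS AGAINST A COARSE REFERENCE** (T-111's `Ct(x) = |h(x,0) − 1| + Σ_{y≠0}|h(x,y)|` shape — any side, any `g : ℤ^d → ℝ`):
`Σ_{y∈Y}|H(p,y) − g y| ≤ Σ_{y∈Y}|φ(p − (n+1)y) − g y| + √(Σ_{y∈Y} w(blk p − y)⁻²)·√(Σ'_q (w(blk q)·(H(q,0) − φ q))²)`. [folklore] -/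
theorem rowSum_kerH_sub_le (n : ℕ) {a : ℝ} (ha : 0 < a) (φ : X d → ℝ) (S : Finset (X d)) (hS : ∀ q ∉ S, φ q = 0)
    (w : X d → ℝ) (W : ℝ) (hw0 : ∀ y, 0 < w y) (hwW : ∀ y, w y ≤ W) (g : X d → ℝ) (p : X d) (Y : Finset (X d)) :
    ∑ y ∈ Y, |kerH n a p y - g y| ≤ ∑ y ∈ Y, |φ (p - bshift n y) - g y| +
      Real.sqrt (∑ y ∈ Y, ((w (blk n p - y))⁻¹) ^ 2) * Real.sqrt (∑' q, (w (blk n q) * (kerH n a q 0 - φ q)) ^ 2) := by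
  have key := rowSum_kerH_sub_competitor_le n ha φ S hS w W hw0 hwW p Y
  calc ∑ y ∈ Y, |kerH n a p y - g y| ≤ ∑ y ∈ Y, (|φ (p - bshift n y) - g y| + |kerH n a p y - φ (p - bshift n y)|) :=
        Finset.sum_le_sum fun y _ => by
          have h := abs_add_le (φ (p - bshift n y) - g y) (kerH n a p y - φ (p - bshift n y))
          rwa [show φ (p - bshift n y) - g y + (kerH n a p y - φ (p - bshift n y)) = kerH n a p y - g y by ring] at h
    _ = ∑ y ∈ Y, |φ (p - bshift n y) - g y| + ∑ y ∈ Y, |kerH n a p y - φ (p - bshift n y)| := Finset.sum_add_distrib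
    _ ≤ _ := add_le_add le_rfl key

/-- **ROW SUMS, A-POSTERIORI** (`g = 0`): `Σ_{y∈Y}|H(p,y)| ≤ Σ_{y∈Y}|φ(p − (n+1)y)| + √(Σ_{y∈Y} w(blk p − y)⁻²)·√(Σ'_q (w(blk q)·(H(q,0) − φ q))²)`.
[folklore] -/
theorem rowSum_kerH_le (n : ℕ) {a : ℝ} (ha : 0 < a) (φ : X d → ℝ) (S : Finset (X d)) (hS : ∀ q ∉ S, φ q = 0)
    (w : X d → ℝ) (W : ℝ) (hw0 : ∀ y, 0 < w y) (hwW : ∀ y, w y ≤ W) (p : X d) (Y : Finset (X d)) :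
    ∑ y ∈ Y, |kerH n a p y| ≤ ∑ y ∈ Y, |φ (p - bshift n y)| +
      Real.sqrt (∑ y ∈ Y, ((w (blk n p - y))⁻¹) ^ 2) * Real.sqrt (∑' q, (w (blk n q) * (kerH n a q 0 - φ q)) ^ 2) := by
  simpa only [sub_zero] using rowSum_kerH_sub_le n ha φ S hS w W hw0 hwW (fun _ => 0) p Y

/-- **ROW SUMS FROM THE RESIDUAL** (`rowSum_kerH_le` + `agmon_kerH`, `m := gap − d·η > 0`):
`Σ_{y∈Y}|H(p,y)| ≤ Σ_{y∈Y}|φ(p − (n+1)y)| + √(Σ_{y∈Y} w(blk p − y)⁻²)·√(Σ_{q∈T}(w(blk q)·P(−Δ)φ q)²)∕m` — a FINITE expression in `φ`, `w`. [folklore] -/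
theorem rowSum_kerH_le_of_residual (n : ℕ) (hn : 1 ≤ n) {a : ℝ} (ha : 0 < a) (φ : X d → ℝ) (S : Finset (X d))
    (hS : ∀ q ∉ S, φ q = 0) (hφ : ∀ y : X d, ∑ q ∈ B n y, φ q = ((n : ℝ) + 1) ^ d * (if y = 0 then 1 else 0))
    (T : Finset (X d))
    (hT : ∀ q ∉ T, lapRow φ q - (((n : ℝ) + 1) ^ d)⁻¹ * ∑ r ∈ B n (blk n q), lapRow φ r = 0)
    (w : X d → ℝ) (η W : ℝ) (hw0 : ∀ y, 0 < w y) (hwW : ∀ y, w y ≤ W) (hη : 0 ≤ η)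
    (hwρ : ∀ (y : X d) (μ : Fin d), w y / w (y + e μ) + w (y + e μ) / w y ≤ 2 + 2 * η)
    (gap : ℝ) (hm : 0 < gap - d * η)
    (hgap : ∀ (y : X d) (u : X d → ℝ), ∑ q ∈ B n y, u q = 0 →
      gap * ∑ q ∈ B n y, u q ^ 2 ≤ ∑ q ∈ B n y, ∑ μ : Fin d, (if loc n q μ < n then (u q - u (q + e μ)) ^ 2 else 0))
    (p : X d) (Y : Finset (X d)) :
    ∑ y ∈ Y, |kerH n a p y| ≤ ∑ y ∈ Y, |φ (p - bshift n y)| +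
      Real.sqrt (∑ y ∈ Y, ((w (blk n p - y))⁻¹) ^ 2) *
        (Real.sqrt (∑ q ∈ T, (w (blk n q) * (lapRow φ q - (((n : ℝ) + 1) ^ d)⁻¹ * ∑ r ∈ B n (blk n q), lapRow φ r)) ^ 2) /
          (gap - d * η)) := by
  have h1 := rowSum_kerH_le n ha φ S hS w W hw0 hwW p Y
  have h2 := agmon_kerH n hn ha φ S hS hφ T hT w η W hw0 hwW hη hwρ gap hgap
  have h3 : Real.sqrt (∑' q, (w (blk n q) * (kerH n a q 0 - φ q)) ^ 2) ≤
      Real.sqrt (∑ q ∈ T, (w (blk n q) * (lapRow φ q - (((n : ℝ) + 1) ^ d)⁻¹ * ∑ r ∈ B n (blk n q), lapRow φ r)) ^ 2) /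
        (gap - d * η) := by
    rw [le_div_iff₀ hm, mul_comm]; exact h2
  exact h1.trans (add_le_add le_rfl (mul_le_mul_of_nonneg_left h3 (Real.sqrt_nonneg _)))

/-- **THE (A-cert) SHAPE** (T-111 road (A) ∕ NC-NE7b-GAMMA-1-A as ONE inequality), typed with a WEIGHT FAMILY — one block weight PER WINDOW, all with
the same ratio constant `η` (a single bounded weight cannot have uniformly bounded inverse-square row sums on `ℤ^d`; the truncations `t^{min(|·|₁, T(Y))}`
of `BlockSectionRowSumCertificate` are such a family): if for every finite window `Y` some admissible weight has `Σ_{y∈Y} w(blk p − y)⁻² ≤ Cw` and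
`Σ_{q∈T}(w(blk q)·P(−Δ)φ q)² ≤ Rb²`, and `φ`'s own row sums are `≤ A`, then `y ↦ |H(p,y)|` is summable and
`Σ'_y |H(p,y)| ≤ A + √Cw·Rb∕(gap − d·η)`. [folklore] -/
theorem tsum_abs_kerH_le_of_family (n : ℕ) (hn : 1 ≤ n) {a : ℝ} (ha : 0 < a) (φ : X d → ℝ) (S : Finset (X d))
    (hS : ∀ q ∉ S, φ q = 0) (hφ : ∀ y : X d, ∑ q ∈ B n y, φ q = ((n : ℝ) + 1) ^ d * (if y = 0 then 1 else 0))
    (T : Finset (X d))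
    (hT : ∀ q ∉ T, lapRow φ q - (((n : ℝ) + 1) ^ d)⁻¹ * ∑ r ∈ B n (blk n q), lapRow φ r = 0)
    (η : ℝ) (hη : 0 ≤ η) (gap : ℝ) (hm : 0 < gap - d * η)
    (hgap : ∀ (y : X d) (u : X d → ℝ), ∑ q ∈ B n y, u q = 0 →
      gap * ∑ q ∈ B n y, u q ^ 2 ≤ ∑ q ∈ B n y, ∑ μ : Fin d, (if loc n q μ < n then (u q - u (q + e μ)) ^ 2 else 0))
    (p : X d) {A Cw Rb : ℝ} (hRb : 0 ≤ Rb) (hA : ∀ Y : Finset (X d), ∑ y ∈ Y, |φ (p - bshift n y)| ≤ A)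
    (hfam : ∀ Y : Finset (X d), ∃ (w : X d → ℝ) (W : ℝ), (∀ y, 0 < w y) ∧ (∀ y, w y ≤ W) ∧
      (∀ (y : X d) (μ : Fin d), w y / w (y + e μ) + w (y + e μ) / w y ≤ 2 + 2 * η) ∧
      (∑ y ∈ Y, ((w (blk n p - y))⁻¹) ^ 2 ≤ Cw) ∧
      (∑ q ∈ T, (w (blk n q) * (lapRow φ q - (((n : ℝ) + 1) ^ d)⁻¹ * ∑ r ∈ B n (blk n q), lapRow φ r)) ^ 2 ≤ Rb ^ 2)) :
    Summable (fun y => |kerH n a p y|) ∧ ∑' y, |kerH n a p y| ≤ A + Real.sqrt Cw * (Rb / (gap - d * η)) := by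
  have hbound : ∀ Y : Finset (X d), ∑ y ∈ Y, |kerH n a p y| ≤ A + Real.sqrt Cw * (Rb / (gap - d * η)) := by
    intro Y
    obtain ⟨w, W, hw0, hwW, hwρ, hCw, hRes⟩ := hfam Y
    have h := rowSum_kerH_le_of_residual n hn ha φ S hS hφ T hT w η W hw0 hwW hη hwρ gap hm hgap p Y
    have hR : Real.sqrt (∑ q ∈ T, (w (blk n q) *
        (lapRow φ q - (((n : ℝ) + 1) ^ d)⁻¹ * ∑ r ∈ B n (blk n q), lapRow φ r)) ^ 2) ≤ Rb := by
      rw [← Real.sqrt_sq hRb]; exact Real.sqrt_le_sqrt hRes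
    have hRn0 : 0 ≤ Rb / (gap - d * η) := div_nonneg hRb hm.le
    refine h.trans (add_le_add (hA Y) ?_)
    exact mul_le_mul (Real.sqrt_le_sqrt hCw) (div_le_div_of_nonneg_right hR hm.le)
      (div_nonneg (Real.sqrt_nonneg _) hm.le) (Real.sqrt_nonneg _)
  have hs : Summable fun y => |kerH n a p y| := summable_of_sum_le (fun y => abs_nonneg _) hbound
  exact ⟨hs, hs.tsum_le_of_sum_le hbound⟩

end

end Summit.QuantumFields.BalabanUV.T4Continuum.NE7b.BlockSectionAgmonLetter
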